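import Literature.AlgebraicGeometry.Motives.CyclesPushforwardFacts
import Literature.AlgebraicGeometry.Motives.CyclesDivisorDimensionProofs
import Mathlib.AlgebraicGeometry.ZariskisMainTheorem
import Mathlib.Topology.NoetherianSpace
import HarnessLib

/-!
# Finiteness over a neighbourhood of a codimension-one point (Stacks 02RM)

Towards the discharge of `Literature.AlgebraicGeometry.Motives.map_div_eq_div_norm`
(Stacks, Chow Homology, Lemma 42.18.1 = Tag 02RT), whose printed proof begins: "We may apply
Lemma 42.16.2 [Tag 02RM] to the morphism `p : X → Y` and the generic point `ξ ∈ Z`. Hence we may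
replace `Y` by an affine open neighbourhood of `ξ` and assume that `p : X → Y` is finite."

For `p : X → Y` a proper dominant morphism of integral schemes locally of finite type over a
field `K` with `dim X = dim Y = n` (`Order.height ⊤ = n` on both) and `y ∈ Y` of codimension one
(`Order.coheight y = 1`) we prove

* `Literature.AlgebraicGeometry.Motives.finite_preimage_singleton_of_coheight_eq_one`: the fibre
  `p⁻¹(y)` is finite;
* `Literature.AlgebraicGeometry.Motives.exists_isFinite_morphismRestrict_of_coheight_eq_one`:
  Stacks Tag 02RM — some open `V ∋ y` has `p⁻¹(V) → V` finite — by Mathlib's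
  `exists_isFinite_morphismRestrict_of_finite_preimage_singleton` (Stacks Tag 02UP, from
  Zariski's Main Theorem).

Proof of the finiteness of the fibre: by the dimension formula (Stacks 0A21;
`Literature.AlgebraicGeometry.Motives.Scheme.height_add_coheight_eq_height_top`) `height y = n - 1`;
a point `x` over `y` has `height x ≥ height y` (closed maps do not raise dimension) and `x ≠ ⊤`
(the generic point maps to the generic point, `y ≠ ⊤`), so `height x = n - 1`; hence the fibre
carries the trivial specialisation order, and a Noetherian sober space with trivial
specialisation order — such as the fibre scheme `X_y`, of finite type over `κ(y)` — is finite
(`Literature.AlgebraicGeometry.Motives.finite_of_noetherianSpace_of_specializes`).  (Stacks proves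
02RM through Algebra Lemma 10.113.2 instead.)  Everything here is proved.

## References

* [StacksProject] The Stacks Project, Chow Homology, Lemma 42.16.2 (Tag 02RM), Lemma 42.18.1
  (Tag 02RT); More on Morphisms / Cohomology of Schemes, Tag 02UP; Varieties, Tag 0A21.
* [Fulton1998] W. Fulton, *Intersection Theory*, 2nd ed. (1998), Prop. 1.4 (b), proof
  ("Case 2: `f` is finite").
-/

open CategoryTheory AlgebraicGeometry Order Topology TopologicalSpace

universe u

namespace Literature.AlgebraicGeometry.Motives

/-- A Noetherian quasi-sober space with trivial specialisation order is finite: every point is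
the generic point of its irreducible component, and there are finitely many components.
[folklore] -/
theorem finite_of_noetherianSpace_of_specializes {F : Type*} [TopologicalSpace F] [QuasiSober F]
    [NoetherianSpace F] (h : ∀ z z' : F, z ⤳ z' → z = z') : Finite F := by
  have hcomp : ∀ z : F, irreducibleComponent z = {z} := by
    intro z
    obtain ⟨η, hη⟩ := QuasiSober.sober (isIrreducible_irreducibleComponent (x := z))
      (isClosed_irreducibleComponent (x := z))
    have hηz : η ⤳ z := hη.specializes mem_irreducibleComponent
    obtain rfl := h η z hηz
    apply Set.Subset.antisymm
    · intro w hw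
      exact (h η w (hη.specializes hw)).symm ▸ rfl
    · rintro w rfl; exact mem_irreducibleComponent
  haveI : Finite (irreducibleComponents F) :=
    NoetherianSpace.finite_irreducibleComponents.to_subtype
  refine Finite.of_injective (fun z : F ↦ (⟨irreducibleComponent z,
    irreducibleComponent_mem_irreducibleComponents z⟩ : irreducibleComponents F)) ?_
  intro z z' hzz'
  have h1 : irreducibleComponent z = irreducibleComponent z' := congrArg Subtype.val hzz'
  rw [hcomp, hcomp, Set.singleton_eq_singleton_iff] at h1
  exact h1

/-- On an integral scheme a point other than the generic point is strictly below it in the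
specialisation order. [folklore] -/
theorem lt_top_of_ne_top {X : Scheme.{u}} [IsIntegral X] {x : X} (hx : x ≠ ⊤) : x < ⊤ := by
  refine lt_iff_le_not_ge.mpr ⟨le_top, fun h ↦ hx ?_⟩
  have hspec : x ⤳ (⊤ : X) := Scheme.le_iff_specializes.mp h
  refine IsGenericPoint.eq ?_ (genericPoint_spec X)
  rw [isGenericPoint_iff_specializes]
  intro z
  simp only [Set.mem_univ, iff_true]
  exact hspec.trans ((genericPoint_spec X).specializes (Set.mem_univ z))

/-- **The fibre of a proper, dominant, generically finite morphism over a codimension-one point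
is finite** (Stacks, Chow Homology, Lemma 42.16.2 = Tag 02RM, proof: "it suffices to prove that
`f⁻¹({ξ})` is finite"). For `p : X → Y` a closed dominant quasi-compact morphism of integral
schemes locally of finite type over a field with `dim X = dim Y = n` and `y ∈ Y` of codimension
one: every point of `p⁻¹(y)` has dimension `dim y = n - 1` (closed maps do not raise dimension,
and the generic point of `X` maps to the generic point of `Y`), so `p⁻¹(y)` carries the trivial
specialisation order; being Noetherian and sober (as the fibre scheme `X_y`) it is finite.
[cite: StacksProject, Tag 02RM] -/
theorem finite_preimage_singleton_of_coheight_eq_one {K : Type u} [Field K] {X Y : Scheme.{u}}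
    (p : X ⟶ Y) (g : Y ⟶ Spec (.of K)) [IsIntegral X] [IsIntegral Y]
    [LocallyOfFiniteType (p ≫ g)] [LocallyOfFiniteType g] [LocallyOfFiniteType p]
    [QuasiCompact p] [IsDominant p] (hpcl : IsClosedMap p.base) (n : ℕ)
    (hX : height (⊤ : X) = n) (hY : height (⊤ : Y) = n) {y : Y} (hy : coheight y = 1) :
    (p.base ⁻¹' {y}).Finite := by
  -- dimensions: `height y + 1 = n`, and every point over `y` has the same height as `y`
  have hyn : height y + 1 = n := by
    have h := Scheme.height_add_coheight_eq_height_top g y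
    rwa [hy, hY] at h
  have hytop : y ≠ ⊤ := by
    rintro rfl
    rw [coheight_top] at hy
    exact zero_ne_one hy
  have hfib : ∀ x : X, p.base x = y → height x = height y := by
    intro x hx
    refine le_antisymm ?_ (hx ▸ height_base_le_of_isClosedMap p hpcl x)
    have hxtop : x ≠ ⊤ := by
      rintro rfl
      apply hytop
      rw [← hx]
      exact RatFn.genericPoint_eq_of_isDominant p
    have hlt : height x < height (⊤ : X) :=
      height_strictMono (lt_top_of_ne_top hxtop)
        (lt_of_le_of_lt (height_mono le_top) (hX ▸ ENat.coe_lt_top n))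
    rw [hX, ← hyn] at hlt
    exact Order.le_of_lt_add_one hlt
  have hyfin : height y < ⊤ :=
    lt_of_le_of_lt (le_self_add.trans_eq hyn) (ENat.coe_lt_top n)
  -- the fibre carries the trivial specialisation order
  have hanti : ∀ x x' : X, p.base x = y → p.base x' = y → x ⤳ x' → x = x' := by
    intro x x' hx hx' hxx'
    by_contra hne
    have hlt : x' < x := lt_iff_le_not_ge.mpr ⟨Scheme.le_iff_specializes.mpr hxx', fun h ↦ hne
      ((Scheme.le_iff_specializes.mp h).antisymm hxx').eq.symm⟩
    have := height_strictMono hlt (by rw [hfib x' hx']; exact hyfin)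
    rw [hfib x hx, hfib x' hx'] at this
    exact lt_irrefl _ this
  -- the fibre scheme `X_y` is Noetherian and sober, with trivial specialisation order, so finite
  haveI : LocallyOfFiniteType (p.fiberToSpecResidueField y) :=
    MorphismProperty.pullback_snd _ _ inferInstance
  haveI : IsLocallyNoetherian (p.fiber y) :=
    LocallyOfFiniteType.isLocallyNoetherian (p.fiberToSpecResidueField y)
  haveI : IsNoetherian (p.fiber y) := {}
  have hfin : Finite (p.fiber y) := by
    refine finite_of_noetherianSpace_of_specializes fun z z' hzz' ↦ (p.fiberι y).injective ?_
    have hz : p.base (p.fiberι y z) = y := by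
      have := Scheme.Hom.range_fiberι p y ▸ Set.mem_range_self (f := (p.fiberι y).base) z
      exact this
    have hz' : p.base (p.fiberι y z') = y := by
      have := Scheme.Hom.range_fiberι p y ▸ Set.mem_range_self (f := (p.fiberι y).base) z'
      exact this
    exact hanti _ _ hz hz' (hzz'.map (p.fiberι y).continuous)
  rw [← Scheme.Hom.range_fiberι]
  exact Set.finite_range _

/-- **Stacks, Chow Homology, Lemma 42.16.2 (Tag 02RM)** in the equidimensional case: for
`p : X → Y` a proper dominant morphism of integral schemes locally of finite type over a field
with `dim X = dim Y`, every codimension-one point `y ∈ Y` has an open neighbourhood `V` with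
`p⁻¹(V) → V` finite (the fibre over `y` is finite,
`Literature.AlgebraicGeometry.Motives.finite_preimage_singleton_of_coheight_eq_one`, and Mathlib's
`exists_isFinite_morphismRestrict_of_finite_preimage_singleton` = Stacks Tag 02UP, via Zariski's
Main Theorem). [cite: StacksProject, Tag 02RM] -/
theorem exists_isFinite_morphismRestrict_of_coheight_eq_one {K : Type u} [Field K]
    {X Y : Scheme.{u}} (p : X ⟶ Y) (g : Y ⟶ Spec (.of K)) [IsIntegral X] [IsIntegral Y]
    [LocallyOfFiniteType (p ≫ g)] [LocallyOfFiniteType g] [IsProper p] [IsDominant p] (n : ℕ)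
    (hX : height (⊤ : X) = n) (hY : height (⊤ : Y) = n) {y : Y} (hy : coheight y = 1) :
    ∃ V : Y.Opens, y ∈ V ∧ IsFinite (p ∣_ V) :=
  haveI : LocallyOfFiniteType p := locallyOfFiniteType_of_comp p g
  exists_isFinite_morphismRestrict_of_finite_preimage_singleton p y
    (finite_preimage_singleton_of_coheight_eq_one p g p.isClosedMap n hX hY hy)

end Literature.AlgebraicGeometry.Motives
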